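import Summits.ABC.StewartYu.PadicG3ParC
import HarnessLib

/-!
# The `p`-adic Gen-3 parameter record — part D: the budget pieces (allowances) and their sizes

Support file (closed forms + plain theorems; no named facts). Continues `PadicG3ParB/C` (K-M3.1 page
HOME/p1/K-M3-1-padic-ledger.md §4; record-side analysis HOME/p1/D-m0-record-budget.md).

The ALLOWANCES are closed forms over the record `P : PadicG3Par n`; each dominates one archimedean or
`p`-adic size occurring in the frames' k-step (`PadicG3ValuesGen.g3_kstep` at odd `p`,
`TwoSetup.g3_slab_kstep` at `p = 2`, shape `max (U-branch) (Schwarz-branch) < 1/K(x₁, τ)`):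
* `hts ν = 2^ν·n·X·L` — the height of a level-`s` monomial value at a node `|x₁| ≤ 2^{ν+1} X_s ≤ 2^{ν+s} X`
  with RELATIVE exponents `≤ L/(2^s Aⱼ)` (`log monDen ≤ hts ν`);
* `AH = Mord₀₀·H·(log 4 + 4) + H` — the normalisation `ν(H)^{m₀}·e^{H/e}` of the `Y₀`-weights
  (`abs_zeroWeight_le`, `lcmUpto_le_exp`);
* `AV = L₀·(Ŝ + n + 5)·log 2` — the factor `(e(1 + |y|/H))^{ℓ₀}`, `|y| ≤ 2^{Ŝ+n} X`, `X ≤ 9H`;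
* `AW = Mord₀₀·(W_L + log(n+1) + 3)` — the directional weights `∏ₖ multichoose(𝔛ₖ, mₖ)`, `|𝔛ₖ| ≤ 2BL`,
  `Σ mₖ ≤ Mord₀₀` (and `Xb^{|t|}`);
* `AY = L₀·(G + 2) + 2H` — the `Y₀`-weights on the BIG disc of radius `p^{θ_m}` (degree `≤ L₀`, Fel'dman
  denominators `v_p ≤ (ℓ₀+H)/(p−1)`); `AY1 = L₀ + H + W` — the same on the UNIT disc plus the pivot `‖1/b_{j₀}‖`;
* `lunk = log(L₀+1) + n·log 2L` (`log #unk`); `Acoef = 3·hts 0 + AH + AV + AW` — the level-`0` Siegel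
  coefficient size (B2) (`|Dclear·qTerm| ≤ e^{Acoef}`); `logK ν = 2·lunk + (Acoef + 1) + (AH + AV + AW) + 4·hts ν`
  — the Liouville constant at a k-step target of stage `ν`; `Acond s ν = N·t + t·log 2N + T_s`
  (`N = 2^{ν+1}X_s + 1` nodes, `t = T_s + 1`: the conditioning `p^{condExp}·p^{(t−1)/(p−1)}` of the U-branch,
  using `log p ≤ p − 1`).
This file: the definitions, their signs, and the PIECE BOUNDS in the unit `Z = G·X·L` (from `PadicG3ParB`'s
floors): `hts ν ≤ 2^ν Z/8`, `AH ≤ 1.41 Z`, `AV ≤ Z/4 + yload`, `AY ≤ Z/4 + G + 2 + 2H`, `AY1 ≤ Z/32 + 1`,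
`AW ≤ 0.41 Z`, `lunk ≤ Z/32 + 1`, `log X ≤ X/4`. The master inequalities (B3)/(B4)/(C0) follow in
`PadicG3ParE`. WHAT THIS IS NOT: the frames' own size lemmas (they prove `their size ≤ allowance`).

## References
* [Nesterenko2003] Yu. V. Nesterenko, *Linear forms in logarithms of rational numbers*, LNM 1819
  (2003) 53–106 — §3.5 Lemma 3.10, §4.2 (4.19)–(4.34), §4.3 (4.38)–(4.45).
-/

noncomputable section

open Finset Real

namespace Summit.ABC.StewartYu

namespace PadicG3Par

variable {n : ℕ} (P : PadicG3Par n)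

/-! ### The allowances -/

/-- height unit at stage `ν`: `hts ν = 2^ν · n · X · L`. [cite: Nesterenko2003, (4.35) and the line after (4.45)] -/
def hts (ν : ℕ) : ℝ := 2 ^ ν * n * P.X * P.L

/-- `ν(H)`-allowance `AH = Mord 0 0 · H · (log 4 + 4) + H`. [cite: Nesterenko2003, Prop 3.1, (3.39)] -/
def AH : ℝ := P.Mord 0 0 * P.H * (Real.log 4 + 4) + P.H

/-- `Y₀`-value allowance `AV = L₀ · ((Ŝ + n + 5) · log 2)`. [cite: Nesterenko2003, (3.37)–(3.39)] -/
def AV : ℝ := P.L₀ * ((P.Sdepth + n + 5) * Real.log 2)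

/-- directional-weights allowance `AW = Mord 0 0 · (W_L + log(n+1) + 3)`. [cite: Nesterenko2003, (4.23)] -/
def AW : ℝ := P.Mord 0 0 * (P.WL + Real.log (n + 1) + 3)

/-- big-disc `Y₀` allowance `AY = L₀ · (G + 2) + 2 H`. [cite: Nesterenko2003, (4.27)–(4.28)] -/
def AY : ℝ := P.L₀ * (P.G + 2) + 2 * P.H

/-- unit-disc `Y₀` allowance plus pivot: `AY1 = L₀ + H + W`. [folklore] -/
def AY1 : ℝ := P.L₀ + P.H + P.W

/-- `log #unk` allowance `lunk = log(L₀ + 1) + n · log(2L)`. [folklore] -/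
def lunk : ℝ := Real.log (P.L₀ + 1) + n * Real.log (2 * P.L)

/-- the level-`0` Siegel coefficient allowance (B2): `Acoef = 3 hts 0 + AH + AV + AW`.
[cite: Nesterenko2003, Prop 3.9 (3.40)] -/
def Acoef : ℝ := 3 * P.hts 0 + P.AH + P.AV + P.AW

/-- the Liouville constant's logarithm at a k-step target of stage `ν`:
`logK ν = 2 lunk + (Acoef + 1) + (AH + AV + AW) + 4 hts ν`. [cite: Nesterenko2003, (4.34)–(4.35)] -/
def logK (ν : ℕ) : ℝ := 2 * P.lunk + (P.Acoef + 1) + (P.AH + P.AV + P.AW) + 4 * P.hts ν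

/-- the U-branch conditioning allowance `Acond s ν = N t + t log(2N) + T_s`, `N = 2^{ν+1} X_s + 1`,
`t = T_s + 1`. [cite: Nesterenko2003, (4.30)] -/
def Acond (s ν : ℕ) : ℝ :=
  (2 ^ (ν + 1) * P.Xs s + 1) * (P.T s + 1) + (P.T s + 1) * Real.log (2 * (2 ^ (ν + 1) * P.Xs s + 1)) + P.T s

/-! ### Elementary signs -/

/-- `0 ≤ hts ν`. [folklore] -/
theorem hts_nonneg (ν : ℕ) : 0 ≤ P.hts ν := by unfold hts; positivity

/-- `16 ≤ G` (`G ≥ 8(n+1)`, `n ≥ 1`). [folklore] -/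
theorem sixteen_le_G : (16 : ℝ) ≤ P.G := by
  have h := P.cG_mul_le_G
  have hn : (1 : ℝ) ≤ n := by exact_mod_cast P.hn
  simp only [cG] at h
  nlinarith

/-- `16 ≤ yload`. [folklore] -/
theorem sixteen_le_yload : (16 : ℝ) ≤ P.yload := le_trans P.sixteen_le_G P.G_le_yload

/-- `2^25 ≤ L`. [folklore] -/
theorem two_pow_25_le_L : (2 : ℝ) ^ 25 ≤ P.L := by
  have h1 : 2 ^ 25 ≤ 2 ^ (n + 24) := Nat.pow_le_pow_right (by norm_num) (by have := P.hn; omega)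
  have h2 := P.two_pow_le_L
  exact_mod_cast h1.trans h2

/-- `1 ≤ W_L` (from `W + log 2L + 1 ≤ W_L`). [folklore] -/
theorem WL_ge_one : 1 ≤ P.WL := by
  have h := P.W_add_log_le_WL
  have hL : (1 : ℝ) ≤ P.L := P.one_le_L
  have : 0 ≤ Real.log (2 * P.L) := Real.log_nonneg (by linarith)
  linarith [P.hW]

/-- `0 ≤ AH`, `0 ≤ AV`, `0 ≤ AW`, `0 ≤ lunk`. [folklore] -/
theorem pieces_nonneg : 0 ≤ P.AH ∧ 0 ≤ P.AV ∧ 0 ≤ P.AW ∧ 0 ≤ P.lunk := by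
  have h4 : 0 ≤ Real.log 4 + 4 := by have := Real.log_nonneg (show (1:ℝ) ≤ 4 by norm_num); linarith
  have hl2 : 0 ≤ Real.log 2 := Real.log_nonneg (by norm_num)
  have hWL := P.WL_ge_one
  have hln : 0 ≤ Real.log ((n : ℝ) + 1) := Real.log_nonneg (by linarith [(Nat.cast_nonneg n : (0:ℝ) ≤ n)])
  have hL : (1 : ℝ) ≤ P.L := P.one_le_L
  refine ⟨?_, ?_, ?_, ?_⟩
  · unfold AH; positivity
  · unfold AV; positivity
  · unfold AW; positivity
  · unfold lunk
    have h1 : 0 ≤ Real.log ((P.L₀ : ℝ) + 1) := Real.log_nonneg (by linarith [(Nat.cast_nonneg P.L₀ : (0:ℝ) ≤ P.L₀)])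
    have h2 : 0 ≤ Real.log (2 * (P.L : ℝ)) := Real.log_nonneg (by linarith)
    positivity

/-- `0 ≤ Acoef` (so the frame may take `Amax := exp Acoef ≥ 1` in `G3Setup.siegel_slab`). [folklore] -/
theorem Acoef_nonneg : 0 ≤ P.Acoef := by
  obtain ⟨h1, h2, h3, _⟩ := P.pieces_nonneg
  have := P.hts_nonneg 0
  unfold Acoef; positivity

/-! ### Every allowance is a fraction of `Z = G X L` -/

/-- `Z ≥ 16 · 72 · 2^25` (so constants are negligible). [folklore] -/
theorem GXL_ge : (16 : ℝ) * 72 * 2 ^ 25 ≤ P.G * P.X * P.L := by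
  have hG := P.sixteen_le_G
  have hX := P.seventytwo_le_X
  have hL := P.two_pow_25_le_L
  have := mul_le_mul hG hX (by norm_num) (by linarith)
  exact mul_le_mul this hL (by positivity) (by positivity)

/-- `L ≤ Z/1152` (`G ≥ 16`, `X ≥ 72`). [folklore] -/
theorem L_le_GXL : (P.L : ℝ) ≤ P.G * P.X * P.L / 1152 := by
  have hG := P.sixteen_le_G
  have hX := P.seventytwo_le_X
  have hL : (0 : ℝ) ≤ P.L := by positivity
  rw [le_div_iff₀ (by norm_num)]
  have := mul_le_mul hG hX (by norm_num) (by linarith)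
  nlinarith

/-- `(n+1) L ≤ Z/576` (`X ≥ 36(n+1)`, `G ≥ 16`). [folklore] -/
theorem succ_mul_L_le : ((n : ℝ) + 1) * P.L ≤ P.G * P.X * P.L / 576 := by
  have hG := P.sixteen_le_G
  have hX := P.X_ge
  have hL : (0 : ℝ) ≤ P.L := by positivity
  have h0 : (0 : ℝ) ≤ n + 1 := by positivity
  rw [le_div_iff₀ (by norm_num)]
  have := mul_le_mul hG hX (by positivity) (by linarith)
  nlinarith

/-- `(n+1) L G ≤ Z/36` (`X ≥ 36(n+1)`). [folklore] -/
theorem succ_mul_L_mul_G_le : ((n : ℝ) + 1) * P.L * P.G ≤ P.G * P.X * P.L / 36 := by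
  have hX := P.X_ge
  have hL : (0 : ℝ) ≤ P.L := by positivity
  have hG : (0 : ℝ) ≤ P.G := by linarith [P.eight_le_G]
  rw [le_div_iff₀ (by norm_num)]
  nlinarith [mul_le_mul_of_nonneg_left hX (mul_nonneg hL hG)]

/-- **`hts ν ≤ 2^ν · Z/8`** (`n ≤ G/8`). [folklore] -/
theorem hts_le (ν : ℕ) : P.hts ν ≤ 2 ^ ν * (P.G * P.X * P.L) / 8 := by
  unfold hts
  have hn := P.n_le
  have h0 : (0 : ℝ) ≤ 2 ^ ν * P.X * P.L := by positivity
  have : (n : ℝ) ≤ P.G / 8 := by linarith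
  calc (2 : ℝ) ^ ν * n * P.X * P.L = n * (2 ^ ν * P.X * P.L) := by ring
    _ ≤ P.G / 8 * (2 ^ ν * P.X * P.L) := mul_le_mul_of_nonneg_right this h0
    _ = 2 ^ ν * (P.G * P.X * P.L) / 8 := by ring

/-- **`AH ≤ 1.41 · Z`** (`Mord₀₀ ≤ (448/27)(n+1)L`, `H ≤ GX/(64(n+1))`, `log 4 + 4 < 5.39`). [folklore] -/
theorem AH_le : P.AH ≤ (141 / 100) * (P.G * P.X * P.L) := by
  have hM := P.Mord_zero_zero_le'
  have hH := P.H_le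
  have hκ : Real.log 4 + 4 ≤ 539 / 100 := by
    have := Real.log_two_lt_d9
    rw [show (4 : ℝ) = 2 ^ 2 by norm_num, Real.log_pow]; push_cast; linarith
  have hκ0 : 0 ≤ Real.log 4 + 4 := by have := Real.log_nonneg (show (1:ℝ) ≤ 4 by norm_num); linarith
  have hH0 : (0 : ℝ) ≤ P.H := by positivity
  have hG : 0 < P.G := by linarith [P.eight_le_G]
  have hX : (0 : ℝ) ≤ P.X := by positivity
  have hL : (1 : ℝ) ≤ P.L := P.one_le_L
  have hn1 : (0 : ℝ) < n + 1 := by positivity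
  have hMH : (P.Mord 0 0 : ℝ) * P.H ≤ (7 / 27) * (P.G * P.X * P.L) := by
    calc (P.Mord 0 0 : ℝ) * P.H ≤ ((448 / 27) * (n + 1) * P.L) * (P.G * P.X / (64 * (n + 1))) :=
          mul_le_mul hM hH hH0 (by positivity)
      _ = (7 / 27) * (P.G * P.X * P.L) := by field_simp; ring
  have hH' : (P.H : ℝ) ≤ P.G * P.X * P.L / 128 := by
    calc (P.H : ℝ) ≤ P.G * P.X / (64 * (n + 1)) := hH
      _ ≤ P.G * P.X / 128 := by
          apply div_le_div_of_nonneg_left (by positivity) (by norm_num)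
          have hn : (1 : ℝ) ≤ n := by exact_mod_cast P.hn
          linarith
      _ ≤ P.G * P.X * P.L / 128 := by
          apply div_le_div_of_nonneg_right _ (by norm_num)
          have hGX : 0 ≤ P.G * P.X := by positivity
          nlinarith
  unfold AH
  have h1 : (P.Mord 0 0 : ℝ) * P.H * (Real.log 4 + 4) ≤ (7 / 27) * (P.G * P.X * P.L) * (539 / 100) :=
    mul_le_mul hMH hκ hκ0 (by positivity)
  nlinarith

/-- **`AV ≤ Z/4 + yload`** (`L₀ ≤ Z/(4·yload) + 1` and `(Ŝ+n+5) log 2 ≤ yload`). [folklore] -/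
theorem AV_le : P.AV ≤ P.G * P.X * P.L / 4 + P.yload := by
  have hL₀ := P.L₀_le
  have hY := P.yload_pos
  have hl2 : 0 ≤ Real.log 2 := Real.log_nonneg (by norm_num)
  have hl2' : Real.log 2 ≤ 1 := by have := Real.log_two_lt_d9; linarith
  set c : ℝ := ((P.Sdepth : ℝ) + n + 5) * Real.log 2 with hc
  have hc0 : 0 ≤ c := by positivity
  have hcY : c ≤ P.yload := by
    unfold yload
    have h1 : 0 ≤ Real.log P.p := P.log_p_pos.le
    have h3 : (0 : ℝ) ≤ Real.log (n + 1) := Real.log_nonneg (by linarith [(Nat.cast_nonneg n : (0:ℝ) ≤ n)])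
    have hG : 0 ≤ P.G := by linarith [P.eight_le_G]
    have : c = ((P.Sdepth : ℝ) + n + 1) * Real.log 2 + 4 * Real.log 2 := by rw [hc]; ring
    rw [this]; nlinarith
  have hZ : 0 ≤ P.G * P.X * P.L := by have := P.GXL_ge; linarith
  unfold AV
  rw [← hc]
  calc (P.L₀ : ℝ) * c ≤ (P.G * P.X * P.L / (4 * P.yload) + 1) * c := mul_le_mul_of_nonneg_right hL₀ hc0
    _ = P.G * P.X * P.L / 4 * (c / P.yload) + c := by field_simp
    _ ≤ P.G * P.X * P.L / 4 * 1 + P.yload := by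
        gcongr
        exact (div_le_one hY).mpr hcY
    _ = _ := by ring

/-- **`AY ≤ Z/4 + G + 2 + 2H`**. [folklore] -/
theorem AY_le : P.AY ≤ P.G * P.X * P.L / 4 + P.G + 2 + 2 * P.H := by
  have hL₀ := P.L₀_le
  have hY := P.yload_pos
  have hG : 0 < P.G := by linarith [P.eight_le_G]
  have hGY : P.G + 2 ≤ P.yload := by
    unfold yload
    have h1 : 0 ≤ Real.log P.p := P.log_p_pos.le
    have h2 : 0 ≤ Real.log 2 := Real.log_nonneg (by norm_num)
    have h3 : (0 : ℝ) ≤ Real.log (n + 1) := Real.log_nonneg (by linarith [(Nat.cast_nonneg n : (0:ℝ) ≤ n)])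
    have h4 : (0 : ℝ) ≤ ((P.Sdepth : ℝ) + n + 1) * Real.log 2 := by positivity
    linarith
  have hZ : 0 ≤ P.G * P.X * P.L := by have := P.GXL_ge; linarith
  unfold AY
  calc (P.L₀ : ℝ) * (P.G + 2) + 2 * P.H
      ≤ (P.G * P.X * P.L / (4 * P.yload) + 1) * (P.G + 2) + 2 * P.H := by gcongr
    _ = P.G * P.X * P.L / 4 * ((P.G + 2) / P.yload) + P.G + 2 + 2 * P.H := by field_simp; ring
    _ ≤ P.G * P.X * P.L / 4 * 1 + P.G + 2 + 2 * P.H := by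
        gcongr
        exact (div_le_one hY).mpr hGY
    _ = _ := by ring

/-- **`AY1 ≤ Z/32 + 1`**. [folklore] -/
theorem AY1_le : P.AY1 ≤ P.G * P.X * P.L / 32 + 1 := by
  have hL₀ := P.L₀_le
  have hY := P.yload_pos
  have hY16 := P.sixteen_le_yload
  have hZ : 0 ≤ P.G * P.X * P.L := by have := P.GXL_ge; linarith
  have h1 : P.G * P.X * P.L / (4 * P.yload) ≤ P.G * P.X * P.L / 64 :=
    div_le_div_of_nonneg_left hZ (by norm_num) (by linarith)
  have hH := P.H_le
  have hH' : (P.H : ℝ) ≤ P.G * P.X * P.L / 128 := by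
    calc (P.H : ℝ) ≤ P.G * P.X / (64 * (n + 1)) := hH
      _ ≤ P.G * P.X / 128 := by
          have hG0 : 0 < P.G := lt_of_lt_of_le (by norm_num) P.sixteen_le_G
          apply div_le_div_of_nonneg_left (by positivity) (by norm_num)
          have hn : (1 : ℝ) ≤ n := by exact_mod_cast P.hn
          linarith
      _ ≤ P.G * P.X * P.L / 128 := by
          have hG0 : 0 < P.G := lt_of_lt_of_le (by norm_num) P.sixteen_le_G
          apply div_le_div_of_nonneg_right _ (by norm_num)
          have hGX : 0 ≤ P.G * P.X := by positivity
          nlinarith [P.one_le_L]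
  have hW : P.W ≤ P.G * P.X * P.L / 128 := by
    have h2 := P.W_add_log_le_WL
    have h3 := P.WL_mul_le
    have hlog : 0 ≤ Real.log (2 * (P.L : ℝ)) := Real.log_nonneg (by linarith [P.one_le_L])
    have hn : (1 : ℝ) ≤ n := by exact_mod_cast P.hn
    have hL1 : (1 : ℝ) ≤ P.L := P.one_le_L
    have hWL0 : 0 ≤ P.WL := by linarith [P.WL_ge_one]
    have hWL : P.WL ≤ P.G * P.X * P.L / 128 := by
      have hnL : (2 : ℝ) ≤ (n + 1) * P.L := by nlinarith
      have hn2 : P.WL * 2 ≤ (n + 1) * P.L * P.WL := by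
        calc P.WL * 2 = 2 * P.WL := by ring
          _ ≤ ((n : ℝ) + 1) * P.L * P.WL := mul_le_mul_of_nonneg_right hnL hWL0
      rw [le_div_iff₀ (by norm_num)]
      rw [le_div_iff₀ (by norm_num)] at h3
      nlinarith
    linarith
  unfold AY1
  linarith

/-- **`AW ≤ 0.41 · Z`** (`(n+1)L·W_L ≤ Z/64`, `log(n+1) ≤ n ≤ G/8`, `(n+1) L G ≤ Z/36`, `(n+1)L ≤ Z/576`). [folklore] -/
theorem AW_le : P.AW ≤ (41 / 100) * (P.G * P.X * P.L) := by
  have hM := P.Mord_zero_zero_le'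
  have h1 := P.WL_mul_le
  have h2 := P.succ_mul_L_mul_G_le
  have h3 := P.succ_mul_L_le
  have hn := P.n_le
  have hL : (0 : ℝ) ≤ P.L := by positivity
  have hn0 : (0 : ℝ) ≤ n := by positivity
  have hlog : Real.log ((n : ℝ) + 1) ≤ n := by
    have := Real.log_le_sub_one_of_pos (show (0 : ℝ) < n + 1 by positivity); linarith
  have hlog0 : 0 ≤ Real.log ((n : ℝ) + 1) := Real.log_nonneg (by linarith)
  have hWL := P.WL_ge_one
  -- `(n+1) L (W_L + log(n+1) + 3) ≤ Z (1/64 + 1/288 + 1/192)`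
  have hA : ((n : ℝ) + 1) * P.L * Real.log (n + 1) ≤ P.G * P.X * P.L / 288 := by
    have : ((n : ℝ) + 1) * P.L * Real.log (n + 1) ≤ ((n : ℝ) + 1) * P.L * (P.G / 8) := by
      apply mul_le_mul_of_nonneg_left _ (by positivity); linarith
    linarith
  have hsum : ((n : ℝ) + 1) * P.L * (P.WL + Real.log (n + 1) + 3) ≤
      (1 / 64 + 1 / 288 + 1 / 192) * (P.G * P.X * P.L) := by nlinarith
  have hpos : 0 ≤ P.WL + Real.log ((n : ℝ) + 1) + 3 := by positivity
  unfold AW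
  calc (P.Mord 0 0 : ℝ) * (P.WL + Real.log (n + 1) + 3)
      ≤ ((448 / 27) * (n + 1) * P.L) * (P.WL + Real.log (n + 1) + 3) :=
        mul_le_mul_of_nonneg_right hM hpos
    _ = (448 / 27) * (((n : ℝ) + 1) * P.L * (P.WL + Real.log (n + 1) + 3)) := by ring
    _ ≤ (448 / 27) * ((1 / 64 + 1 / 288 + 1 / 192) * (P.G * P.X * P.L)) :=
        mul_le_mul_of_nonneg_left hsum (by norm_num)
    _ ≤ (41 / 100) * (P.G * P.X * P.L) := by
        have hZ : 0 ≤ P.G * P.X * P.L := by have := P.GXL_ge; linarith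
        nlinarith

/-- **`lunk ≤ Z/32 + 1`** (`log(L₀+1) ≤ L₀ ≤ Z/64 + 1`, `n log 2L ≤ (n+1) L W_L ≤ Z/64`). [folklore] -/
theorem lunk_le : P.lunk ≤ P.G * P.X * P.L / 32 + 1 := by
  have hL₀ := P.L₀_le
  have hY := P.yload_pos
  have hY16 := P.sixteen_le_yload
  have hZ : 0 ≤ P.G * P.X * P.L := by have := P.GXL_ge; linarith
  have h1 : P.G * P.X * P.L / (4 * P.yload) ≤ P.G * P.X * P.L / 64 :=
    div_le_div_of_nonneg_left hZ (by norm_num) (by linarith)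
  have hlog1 : Real.log ((P.L₀ : ℝ) + 1) ≤ P.L₀ := by
    have := Real.log_le_sub_one_of_pos (show (0 : ℝ) < P.L₀ + 1 by positivity); linarith
  have h2 := P.WL_mul_le
  have hlog2 : Real.log (2 * (P.L : ℝ)) ≤ P.WL := by have := P.W_add_log_le_WL; linarith [P.hW]
  have hlog20 : 0 ≤ Real.log (2 * (P.L : ℝ)) := Real.log_nonneg (by linarith [P.one_le_L])
  have hn : (n : ℝ) * Real.log (2 * P.L) ≤ P.G * P.X * P.L / 64 := by
    have hWL0 : 0 ≤ P.WL := by linarith [P.WL_ge_one]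
    have : (n : ℝ) ≤ (n + 1) * P.L := by nlinarith [P.one_le_L, (Nat.cast_nonneg n : (0:ℝ) ≤ n)]
    calc (n : ℝ) * Real.log (2 * P.L) ≤ ((n : ℝ) + 1) * P.L * P.WL :=
          mul_le_mul this hlog2 hlog20 (by positivity)
      _ ≤ _ := h2
  unfold lunk
  linarith

/-- `log X ≤ X/4` (as `X ≥ 72`). [folklore] -/
theorem log_X_le : Real.log (P.X : ℝ) ≤ P.X / 4 := by
  have hX := P.seventytwo_le_X
  have hy : (0 : ℝ) ≤ P.X / 4 := by linarith
  have h1 := Real.quadratic_le_exp_of_nonneg hy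
  have h2 : (P.X : ℝ) ≤ Real.exp (P.X / 4) := by nlinarith
  calc Real.log (P.X : ℝ) ≤ Real.log (Real.exp (P.X / 4)) := Real.log_le_log (by linarith) h2
    _ = P.X / 4 := Real.log_exp _

end PadicG3Par

end Summit.ABC.StewartYu
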